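import Summits.ResolutionOfSingularities.ResolutionOfSingularities.Theorems.MarkedTransferCampaignW13RFlatArcCriterion
import Summits.ResolutionOfSingularities.ResolutionOfSingularities.Theorems.MarkedTransferCampaignW13RFlatCanonicalPosSurface
import Mathlib.Algebra.CharP.Lemmas
import Mathlib.Algebra.Ring.GeomSum
import HarnessLib

/-!
# [OURS · L1 W1.3] The rung-1 content Prop on `𝒞_can` FAILS IN EVERY CHARACTERISTIC: for every prime `p` and every field
# `K` of characteristic `p`, `¬ CampaignW13RFlatCanonicalPos p K u` on `K[x,y,z,u]` (seat res-L1-s13-pv-1, g2)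

LADDER-RESOLUTION rung L (rescue), cell `res-hironaka`, RESCUE-SEED slot W1.3 (architecture bypass, reading R-flat), F7′ row 1.
Uniform version of p501051 (`p = 2`, Narasimhan), p503083 (`p = 2`, surface) and p507090 (`p = 3`). THE FAMILY: for a prime `p`
put
  `Q_p(x,y,z) = x·(y − z)^{p−1} − y·z·Σ_{j=0}^{p−2} y^j z^{p−2−j}`   (homogeneous of degree `p`),
  `g_p = u^p + z^p·Q_p(x,y,z)`   (head; `ε_p = z^p Q_p` is free of `u`, `ord ε_p = 2p > q = p`).
KEY IDENTITY (`Qp_mul`, `Qp_shift_mul`; any commutative ring of characteristic `p`): `(y−z)·Q_p = x(y−z)^p − y^p z + y z^p`,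
whence `Q_p(s+a, s+b, s+c) = s^p + Q_p(a,b,c)` — `Q_p` is ADDITIVE AT THE DIAGONAL (freshman's dream for `(s+b)^p`,
`(b−c)^p`). Hence along the arc `γ(t) = (t, t, t, −t²)`: `g_p(γ + v) = v₃^p + t^p·Q_p(v) + t^p·v₂^p + v₂^p·Q_p(v) ∈ (v)^p`
(`AllP_taylor`, `AllP_taylor_mem`), i.e. EVERY Hasse derivative of `g_p` of order `< p` vanishes along `γ` — the arc lies in
the order-`≥ p` locus `top(g_p, p)` — while `u^p∘γ = (−t²)^p ≠ 0`. By the general arc criterion p506602: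
`u^p ∉ ℘_alg(((g_p), p), 1)` (`AllP_tail_pow_not_mem`; stalk form `AllP_mul_tail_pow_not_mem`). The datum (`e = 1`, tail
`u`, `r = 0`) is CANONICAL (`AllP_isCanonicalChain`: every monomial of `ε_p` carries `x¹` or `y^{j+1}` with `j+1 ≤ p−1`),
so **`¬ CampaignW13RFlatCanonicalPos p K (3 : Fin 4)` for every prime `p` and every field `K` of characteristic `p`**
(`Campaign.not_CampaignW13RFlatCanonicalPos_allChar`).

Reading (prover's words; AI bookkeeping weaker than expert review): the R-flat rung-1 feed on the coordinate-bound canonical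
class fails uniformly in the characteristic — «large `p`» is no refuge; what survives is class-wise (𝒞_Diff p482051, affine
parity p504584) and presentation-wise (p503641). Caveat of record: nothing here bears on L-G4 / (127).

HONEST FRAMING. OURS statements about the OURS bypass objects (bound algebraic `℘`, row 003 U17_2; candidate U17_4 not used);
nothing here is a statement of H. Hironaka's manuscript [Hironaka2017] (2017-03-23, lit key `paper:url-3343fd9e678b`); no claim
about resolution of singularities in positive characteristic. All decls `[folklore]`, sorry-free.
-/

noncomputable section

set_option linter.dupNamespace false -- mandated namespace of this single-conjunct summit

namespace Summit.ResolutionOfSingularities.ResolutionOfSingularities.Theorems.Campaign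

open MvPolynomial
open Literature.AlgebraicGeometry.Resolution
open Literature.AlgebraicGeometry.Hironaka2017
open Literature.AlgebraicGeometry.Hironaka2017.S09LLUED (LLChainData)

namespace W13

/-! ## §1 The additive form `Q_p` in any commutative ring of characteristic `p` -/

section Ring

variable {R : Type*} [CommRing R] (p : ℕ) [hp : Fact p.Prime] [CharP R p]

omit [CharP R p] in
/-- `(y − z)·Q_p(x,y,z) = x(y−z)^p − y^p z + y z^p` (telescoping `geom_sum₂_mul`). [folklore] -/
theorem Qp_mul (x y z : R) :
    (y - z) * (x * (y - z) ^ (p - 1) - y * z * ∑ j ∈ Finset.range (p - 1), y ^ j * z ^ (p - 1 - 1 - j)) =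
      x * (y - z) ^ p - y ^ p * z + y * z ^ p := by
  have h1 : (y - z) ^ (p - 1) * (y - z) = (y - z) ^ p := by
    rw [← pow_succ, Nat.sub_add_cancel hp.out.one_le]
  have h2 : (∑ j ∈ Finset.range (p - 1), y ^ j * z ^ (p - 1 - 1 - j)) * (y - z) = y ^ (p - 1) - z ^ (p - 1) :=
    geom_sum₂_mul y z (p - 1)
  have h3 : y ^ (p - 1) * y = y ^ p := by rw [← pow_succ, Nat.sub_add_cancel hp.out.one_le]
  have h4 : z ^ (p - 1) * z = z ^ p := by rw [← pow_succ, Nat.sub_add_cancel hp.out.one_le]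
  calc (y - z) * (x * (y - z) ^ (p - 1) - y * z * ∑ j ∈ Finset.range (p - 1), y ^ j * z ^ (p - 1 - 1 - j))
      = x * ((y - z) ^ (p - 1) * (y - z)) -
          ((∑ j ∈ Finset.range (p - 1), y ^ j * z ^ (p - 1 - 1 - j)) * (y - z)) * y * z := by ring
    _ = x * (y - z) ^ p - (y ^ (p - 1) - z ^ (p - 1)) * y * z := by rw [h1, h2]
    _ = x * (y - z) ^ p - (y ^ (p - 1) * y) * z + y * (z ^ (p - 1) * z) := by ring
    _ = x * (y - z) ^ p - y ^ p * z + y * z ^ p := by rw [h3, h4]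

/-- **Additivity of `Q_p` at the diagonal** (multiplied form, any commutative ring of characteristic `p`):
`(b − c)·Q_p(s+a, s+b, s+c) = (b − c)·(s^p + Q_p(a,b,c))` — freshman's dream `(s+b)^p = s^p + b^p`, `(b−c)^p = b^p − c^p`.
[folklore] -/
theorem Qp_shift_mul (s a b c : R) :
    (b - c) * ((s + a) * ((s + b) - (s + c)) ^ (p - 1) -
        (s + b) * (s + c) * ∑ j ∈ Finset.range (p - 1), (s + b) ^ j * (s + c) ^ (p - 1 - 1 - j)) =
      (b - c) * (s ^ p + (a * (b - c) ^ (p - 1) - b * c * ∑ j ∈ Finset.range (p - 1), b ^ j * c ^ (p - 1 - 1 - j))) := by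
  have hbc : (s + b) - (s + c) = b - c := by ring
  have L := Qp_mul p (s + a) (s + b) (s + c)
  rw [hbc] at L
  rw [hbc, L]
  conv_rhs => rw [mul_add, Qp_mul p a b c]
  rw [add_pow_char s b p, add_pow_char s c p, sub_pow_char b c]
  ring

end Ring

/-! ## §2 The head `g_p = u^p + z^p Q_p(x,y,z)` and the arc `(t, t, t, −t²)` -/

section Head

variable (K : Type) [Field K] (p : ℕ) [hp : Fact p.Prime] [CharP K p]

/-- **Taylor expansion of `g_p` along the arc**: in `K[t][v₀,…,v₃]`,
`g_p(γ + v) = v₃^p + t^p·Q_p(v) + t^p·v₂^p + v₂^p·Q_p(v)` — by `Qp_shift_mul` (cancelling `v₁ − v₂ ≠ 0` in the domain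
`K[t][v]`), freshman's dream and `(−t²)^p = −t^{2p}`. [folklore] -/
theorem AllP_taylor :
    MvPolynomial.aeval (R := K)
        (fun i => (MvPolynomial.C ((![Polynomial.X, Polynomial.X, Polynomial.X, -Polynomial.X ^ 2] :
          Fin 4 → Polynomial K) i) : MvPolynomial (Fin 4) (Polynomial K)) + X i)
        (X 3 ^ p + X 2 ^ p * (X 0 * (X 1 - X 2) ^ (p - 1) -
          X 1 * X 2 * ∑ j ∈ Finset.range (p - 1), X 1 ^ j * X 2 ^ (p - 1 - 1 - j)) : MvPolynomial (Fin 4) K) =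
      X 3 ^ p + MvPolynomial.C (Polynomial.X ^ p) *
          (X 0 * (X 1 - X 2) ^ (p - 1) - X 1 * X 2 * ∑ j ∈ Finset.range (p - 1), X 1 ^ j * X 2 ^ (p - 1 - 1 - j)) +
        MvPolynomial.C (Polynomial.X ^ p) * X 2 ^ p +
        X 2 ^ p * (X 0 * (X 1 - X 2) ^ (p - 1) - X 1 * X 2 * ∑ j ∈ Finset.range (p - 1), X 1 ^ j * X 2 ^ (p - 1 - 1 - j)) := by
  simp only [map_add, map_sub, map_mul, map_pow, map_sum, MvPolynomial.aeval_X, Matrix.cons_val_zero,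
    Matrix.cons_val_one, Matrix.cons_val_two, Matrix.cons_val_three, Matrix.tail_cons, Matrix.head_cons, map_neg]
  set s : MvPolynomial (Fin 4) (Polynomial K) := MvPolynomial.C Polynomial.X with hs
  have hX : (X 1 : MvPolynomial (Fin 4) (Polynomial K)) ≠ X 2 := fun h =>
    absurd (MvPolynomial.X_injective h) (by decide)
  have hQ : (s + X 0) * ((s + X 1) - (s + X 2)) ^ (p - 1) -
      (s + X 1) * (s + X 2) * ∑ j ∈ Finset.range (p - 1), (s + X 1) ^ j * (s + X 2) ^ (p - 1 - 1 - j) =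
        s ^ p + (X 0 * (X 1 - X 2) ^ (p - 1) -
          X 1 * X 2 * ∑ j ∈ Finset.range (p - 1), X 1 ^ j * X 2 ^ (p - 1 - 1 - j)) :=
    mul_left_cancel₀ (sub_ne_zero.mpr hX) (Qp_shift_mul p s (X 0) (X 1) (X 2))
  have hneg : (-s ^ 2) ^ p = (-1) ^ p * (s ^ 2) ^ p := by
    rw [← mul_pow]
    congr 1
    exact (neg_one_mul (s ^ 2)).symm
  rw [hQ, add_pow_char (-s ^ 2) (X 3) p, add_pow_char s (X 2) p, hneg,
    neg_one_pow_char (MvPolynomial (Fin 4) (Polynomial K)) p]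
  ring

omit hp [CharP K p] in
/-- The right-hand side lies in `(v)^p`: `v₃^p`, `v₂^p`, and `Q_p(v)` (`= v₀(v₁−v₂)^{p−1} − v₁v₂·Σ v₁^j v₂^{p−2−j}`, in
`𝔪·𝔪^{p−1}` resp. `𝔪²·𝔪^{p−2}`) all lie in `𝔪^p`, `𝔪 = (v₀,…,v₃)` (for `2 ≤ p`). [folklore] -/
theorem AllP_taylor_mem (hp2 : 2 ≤ p) :
    (X 3 ^ p + MvPolynomial.C (Polynomial.X ^ p) *
          (X 0 * (X 1 - X 2) ^ (p - 1) - X 1 * X 2 * ∑ j ∈ Finset.range (p - 1), X 1 ^ j * X 2 ^ (p - 1 - 1 - j)) +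
        MvPolynomial.C (Polynomial.X ^ p) * X 2 ^ p +
        X 2 ^ p * (X 0 * (X 1 - X 2) ^ (p - 1) - X 1 * X 2 * ∑ j ∈ Finset.range (p - 1), X 1 ^ j * X 2 ^ (p - 1 - 1 - j)) :
          MvPolynomial (Fin 4) (Polynomial K)) ∈ idealOfVars (Fin 4) (Polynomial K) ^ p := by
  have hX : ∀ i : Fin 4, (X i : MvPolynomial (Fin 4) (Polynomial K)) ∈ idealOfVars (Fin 4) (Polynomial K) :=
    fun i => Ideal.subset_span (Set.mem_range_self i)
  have hQ : (X 0 * (X 1 - X 2) ^ (p - 1) - X 1 * X 2 * ∑ j ∈ Finset.range (p - 1), X 1 ^ j * X 2 ^ (p - 1 - 1 - j) :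
      MvPolynomial (Fin 4) (Polynomial K)) ∈ idealOfVars (Fin 4) (Polynomial K) ^ p := by
    refine Ideal.sub_mem _ ?_ ?_
    · have h := Ideal.mul_mem_mul (hX 0) (Ideal.pow_mem_pow (Ideal.sub_mem _ (hX 1) (hX 2)) (p - 1))
      rwa [← pow_succ', Nat.sub_add_cancel (le_trans one_le_two hp2)] at h
    · have hS : (∑ j ∈ Finset.range (p - 1), X 1 ^ j * X 2 ^ (p - 1 - 1 - j) : MvPolynomial (Fin 4) (Polynomial K)) ∈
          idealOfVars (Fin 4) (Polynomial K) ^ (p - 2) := by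
        refine Ideal.sum_mem _ fun j hj => ?_
        have hj' : j + (p - 1 - 1 - j) = p - 2 := by
          have := Finset.mem_range.mp hj
          omega
        have h := Ideal.mul_mem_mul (Ideal.pow_mem_pow (hX 1) j) (Ideal.pow_mem_pow (hX 2) (p - 1 - 1 - j))
        rwa [← pow_add, hj'] at h
      have h := Ideal.mul_mem_mul (Ideal.mul_mem_mul (hX 1) (hX 2)) hS
      have e : idealOfVars (Fin 4) (Polynomial K) * idealOfVars (Fin 4) (Polynomial K) *
          idealOfVars (Fin 4) (Polynomial K) ^ (p - 2) = idealOfVars (Fin 4) (Polynomial K) ^ p := by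
        rw [← pow_two, ← pow_add]
        congr 1
        omega
      rwa [e] at h
  refine Ideal.add_mem _ (Ideal.add_mem _ (Ideal.add_mem _ (Ideal.pow_mem_pow (hX 3) p) (Ideal.mul_mem_left _ _ hQ))
    (Ideal.mul_mem_left _ _ (Ideal.pow_mem_pow (hX 2) p))) ?_
  exact Ideal.mul_mem_left _ _ hQ

/-- **The arc `(t,t,t,−t²)` lies in the order-`≥ p` locus of `g_p`**: `φ(D^{(α)}g_p) = 0` for every Hasse multi-index with
`|α| < p` (p506602 `aeval_hasseDeriv_eq_zero_of_mem_pow`). [folklore] -/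
theorem AllP_arc_hasseDeriv_eq_zero :
    ∀ α : Fin 4 →₀ ℕ, α.degree < p →
      MvPolynomial.aeval ![(Polynomial.X : Polynomial K), Polynomial.X, Polynomial.X, -Polynomial.X ^ 2]
        (hasseDeriv K α
          (X 3 ^ p + X 2 ^ p * (X 0 * (X 1 - X 2) ^ (p - 1) -
            X 1 * X 2 * ∑ j ∈ Finset.range (p - 1), X 1 ^ j * X 2 ^ (p - 1 - 1 - j)) : MvPolynomial (Fin 4) K)) = 0 := by
  classical
  refine aeval_hasseDeriv_eq_zero_of_mem_pow K _ _ p ?_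
  rw [AllP_taylor K p]
  exact AllP_taylor_mem K p hp.out.two_le

omit hp [CharP K p] in
/-- Along the arc: `u^p∘γ = (−t²)^p ≠ 0`. [folklore] -/
theorem AllP_aeval_tail_pow :
    MvPolynomial.aeval ![(Polynomial.X : Polynomial K), Polynomial.X, Polynomial.X, -Polynomial.X ^ 2]
        (X 3 ^ p : MvPolynomial (Fin 4) K) = (-Polynomial.X ^ 2) ^ p ∧ ((-Polynomial.X ^ 2) ^ p : Polynomial K) ≠ 0 := by
  refine ⟨?_, pow_ne_zero _ (neg_ne_zero.mpr (pow_ne_zero _ Polynomial.X_ne_zero))⟩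
  simp only [map_pow, MvPolynomial.aeval_X, Matrix.cons_val_three, Matrix.tail_cons, Matrix.head_cons]

/-- **`u^p ∉ ℘_alg(((g_p), p), 1)`** for every prime `p` and every field of characteristic `p` (bound algebraic `℘` =
degree-1 piece of the integral closure of `O[⊕_{j<p} Diff^{(j)}((g_p))·X^{p−j}]`): general singular-arc criterion p506602.
[folklore] -/
theorem AllP_tail_pow_not_mem :
    (X 3 : MvPolynomial (Fin 4) K) ^ p ∉
      Campaign.pAlgPiece K (Ideal.span {(X 3 ^ p + X 2 ^ p * (X 0 * (X 1 - X 2) ^ (p - 1) -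
        X 1 * X 2 * ∑ j ∈ Finset.range (p - 1), X 1 ^ j * X 2 ^ (p - 1 - 1 - j)) : MvPolynomial (Fin 4) K)}) p 1 := by
  classical
  refine not_mem_pAlgPiece_one_of_singArc_general K
    (MvPolynomial.aeval ![(Polynomial.X : Polynomial K), Polynomial.X, Polynomial.X, -Polynomial.X ^ 2]).toRingHom
    _ p (fun α hα => AllP_arc_hasseDeriv_eq_zero K p α hα) ?_
  change MvPolynomial.aeval _ (X 3 ^ p : MvPolynomial (Fin 4) K) ≠ 0
  rw [(AllP_aeval_tail_pow K p).1]
  exact (AllP_aeval_tail_pow K p).2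

/-- **Stalk-level form**: `s·u^p ∉ ℘_alg(((g_p),p),1)` whenever `s(0) ≠ 0`. [folklore] -/
theorem AllP_mul_tail_pow_not_mem (s : MvPolynomial (Fin 4) K) (hs : coeff 0 s ≠ 0) :
    s * X 3 ^ p ∉
      Campaign.pAlgPiece K (Ideal.span {(X 3 ^ p + X 2 ^ p * (X 0 * (X 1 - X 2) ^ (p - 1) -
        X 1 * X 2 * ∑ j ∈ Finset.range (p - 1), X 1 ^ j * X 2 ^ (p - 1 - 1 - j)) : MvPolynomial (Fin 4) K)}) p 1 := by
  classical
  have hf : ∀ i, ((![(Polynomial.X : Polynomial K), Polynomial.X, Polynomial.X, -Polynomial.X ^ 2]) i).coeff 0 = 0 := by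
    intro i
    fin_cases i <;> simp [Polynomial.coeff_X_pow]
  refine not_mem_pAlgPiece_one_of_singArc_general K
    (MvPolynomial.aeval ![(Polynomial.X : Polynomial K), Polynomial.X, Polynomial.X, -Polynomial.X ^ 2]).toRingHom
    _ p (fun α hα => AllP_arc_hasseDeriv_eq_zero K p α hα) ?_
  change MvPolynomial.aeval _ (s * X 3 ^ p : MvPolynomial (Fin 4) K) ≠ 0
  have h0 : MvPolynomial.aeval ![(Polynomial.X : Polynomial K), Polynomial.X, Polynomial.X, -Polynomial.X ^ 2] s ≠ 0 := by
    intro h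
    have h1 := coeff_zero_aeval_of_coeff_zero K _ hf s
    rw [h, Polynomial.coeff_zero] at h1
    exact hs h1.symm
  rw [map_mul, (AllP_aeval_tail_pow K p).1]
  exact mul_ne_zero h0 (AllP_aeval_tail_pow K p).2

omit [CharP K p] in
/-- **The datum is CANONICAL for every `p`**: `ε_p = z^p Q_p = x·(z^p (y−z)^{p−1}) − y·(z^{p+1}·Σ y^j z^{p−2−j})` is free of
`u`, and every monomial of it has `x`-exponent `1` (first summand) or `y`-exponent in `[1, p−1]` (second summand) — never all
exponents divisible by `p`. [folklore] -/
theorem AllP_isCanonicalChain (d : LLChainData (MvPolynomial (Fin 4) K))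
    (hdg : d.g 0 = X 3 ^ p + X 2 ^ p * (X 0 * (X 1 - X 2) ^ (p - 1) -
      X 1 * X 2 * ∑ j ∈ Finset.range (p - 1), X 1 ^ j * X 2 ^ (p - 1 - 1 - j)))
    (hde : d.e = 1) (hdt : d.tail = X 3) :
    IsCanonicalChain p K (3 : Fin 4) d := by
  classical
  have hx : ∀ i : Fin 4, i ≠ 3 → (X i : MvPolynomial (Fin 4) K) ∈ supported K ({3}ᶜ : Set (Fin 4)) :=
    fun i hi => (X_mem_supported (R := K)).mpr hi
  have h0 := hx 0 (by decide)
  have h1 := hx 1 (by decide)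
  have h2 := hx 2 (by decide)
  refine ⟨X 2 ^ p * (X 0 * (X 1 - X 2) ^ (p - 1) -
      X 1 * X 2 * ∑ j ∈ Finset.range (p - 1), X 1 ^ j * X 2 ^ (p - 1 - 1 - j)), 0, ?_, by simp, ?_,
    by rw [hdt, add_zero], ?_⟩
  · exact not_mem_vars_of_mem_supported (mul_mem (pow_mem h2 p) (sub_mem (mul_mem h0 (pow_mem (sub_mem h1 h2) _))
      (mul_mem (mul_mem h1 h2) (Subalgebra.sum_mem _ fun j _ => mul_mem (pow_mem h1 j) (pow_mem h2 _)))))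
  · rw [hdg, hde, pow_one]
  · rw [hde, pow_one, zero_pow hp.out.ne_zero, sub_zero]
    intro m hm
    have hε : (X 2 ^ p * (X 0 * (X 1 - X 2) ^ (p - 1) -
        X 1 * X 2 * ∑ j ∈ Finset.range (p - 1), X 1 ^ j * X 2 ^ (p - 1 - 1 - j)) : MvPolynomial (Fin 4) K) =
        X 0 * (X 2 ^ p * (X 1 - X 2) ^ (p - 1)) -
          X 1 * (X 2 ^ (p + 1) * ∑ j ∈ Finset.range (p - 1), X 1 ^ j * X 2 ^ (p - 1 - 1 - j)) := by ring
    rw [hε] at hm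
    rcases Finset.mem_union.mp (support_sub (Fin 4) _ _ hm) with h | h
    · -- monomials of `x·F`: `x`-exponent `1`
      rw [support_X_mul, Finset.mem_map] at h
      obtain ⟨m', hm', rfl⟩ := h
      have hF : degreeOf 0 (X 2 ^ p * (X 1 - X 2) ^ (p - 1) : MvPolynomial (Fin 4) K) ≤ 0 := by
        calc degreeOf 0 (X 2 ^ p * (X 1 - X 2) ^ (p - 1) : MvPolynomial (Fin 4) K)
            ≤ degreeOf 0 (X 2 ^ p : MvPolynomial (Fin 4) K) +
                degreeOf 0 ((X 1 - X 2) ^ (p - 1) : MvPolynomial (Fin 4) K) := degreeOf_mul_le _ _ _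
          _ ≤ 0 + (p - 1) * degreeOf 0 (X 1 - X 2 : MvPolynomial (Fin 4) K) := by
              rw [degreeOf_X_pow_of_ne _ (show (0 : Fin 4) ≠ 2 by decide)]
              exact add_le_add le_rfl (degreeOf_pow_le _ _ _)
          _ ≤ 0 + (p - 1) * 0 := by
              have hsub : degreeOf 0 (X 1 - X 2 : MvPolynomial (Fin 4) K) ≤ 0 := by
                refine (degreeOf_sub_le _ _ _).trans ?_
                rw [degreeOf_X, degreeOf_X, if_neg (show (0 : Fin 4) ≠ 1 by decide),
                  if_neg (show (0 : Fin 4) ≠ 2 by decide), max_self]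
              exact add_le_add le_rfl (Nat.mul_le_mul_left _ hsub)
          _ = 0 := by simp
      have hm'0 : m' 0 = 0 := Nat.eq_zero_of_le_zero ((degreeOf_le_iff.mp hF) m' hm')
      refine ⟨0, ?_⟩
      rw [addLeftEmbedding_apply, Finsupp.add_apply, Finsupp.single_eq_same, hm'0, add_zero]
      exact hp.out.not_dvd_one
    · -- monomials of `y·H`: `y`-exponent in `[1, p-1]`
      rw [support_X_mul, Finset.mem_map] at h
      obtain ⟨m', hm', rfl⟩ := h
      have hH : degreeOf 1 (X 2 ^ (p + 1) * ∑ j ∈ Finset.range (p - 1), X 1 ^ j * X 2 ^ (p - 1 - 1 - j) :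
          MvPolynomial (Fin 4) K) ≤ p - 2 := by
        calc degreeOf 1 (X 2 ^ (p + 1) * ∑ j ∈ Finset.range (p - 1), X 1 ^ j * X 2 ^ (p - 1 - 1 - j) :
              MvPolynomial (Fin 4) K)
            ≤ degreeOf 1 (X 2 ^ (p + 1) : MvPolynomial (Fin 4) K) +
                degreeOf 1 (∑ j ∈ Finset.range (p - 1), X 1 ^ j * X 2 ^ (p - 1 - 1 - j) : MvPolynomial (Fin 4) K) :=
              degreeOf_mul_le _ _ _
          _ ≤ 0 + (p - 2) := by
              rw [degreeOf_X_pow_of_ne _ (show (1 : Fin 4) ≠ 2 by decide)]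
              refine add_le_add le_rfl ((degreeOf_sum_le _ _ _).trans (Finset.sup_le fun j hj => ?_))
              have hj := Finset.mem_range.mp hj
              calc degreeOf 1 (X 1 ^ j * X 2 ^ (p - 1 - 1 - j) : MvPolynomial (Fin 4) K)
                  ≤ degreeOf 1 (X 1 ^ j : MvPolynomial (Fin 4) K) +
                      degreeOf 1 (X 2 ^ (p - 1 - 1 - j) : MvPolynomial (Fin 4) K) := degreeOf_mul_le _ _ _
                _ = j := by
                    rw [degreeOf_X_self_pow, degreeOf_X_pow_of_ne _ (show (1 : Fin 4) ≠ 2 by decide), add_zero]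
                _ ≤ p - 2 := by omega
          _ = p - 2 := zero_add _
      have hm'1 : m' 1 ≤ p - 2 := (degreeOf_le_iff.mp hH) m' hm'
      refine ⟨1, ?_⟩
      rw [addLeftEmbedding_apply, Finsupp.add_apply, Finsupp.single_eq_same]
      have hp2 := hp.out.two_le
      exact Nat.not_dvd_of_pos_of_lt (by omega) (by omega)

/-- **`¬ RFlatTailPow p`** (v4 schema) for every chain datum on `g_p` with `e = 1` and the canonical tail `u`. [folklore] -/
theorem AllP_not_rFlatTailPow (d : LLChainData (MvPolynomial (Fin 4) K))
    (hdg : d.g 0 = X 3 ^ p + X 2 ^ p * (X 0 * (X 1 - X 2) ^ (p - 1) -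
      X 1 * X 2 * ∑ j ∈ Finset.range (p - 1), X 1 ^ j * X 2 ^ (p - 1 - 1 - j)))
    (hde : d.e = 1) (hdt : d.tail = X 3) :
    ¬ Campaign.RFlatTailPow p K (Ideal.span {d.g 0}) (p ^ d.e) d := by
  rw [Campaign.RFlatTailPow, hdg, hde, hdt, pow_one]
  exact AllP_tail_pow_not_mem K p

end Head

end W13

/-! ## §3 The content Prop fails in EVERY positive characteristic -/

section HeadlineAllP

/-- **REFUTATION of `Campaign.CampaignW13RFlatCanonicalPos p K (3 : Fin 4)` for EVERY prime `p` and EVERY field `K` of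
characteristic `p`** (chart `K[x,y,z,u]`, tail variable `u`): the canonical datum on `g_p = u^p + z^p·Q_p(x,y,z)` violates
`RFlatTailPow` (`W13.AllP_not_rFlatTailPow`). [folklore] -/
theorem not_CampaignW13RFlatCanonicalPos_allChar (K : Type) [Field K] (p : ℕ) [Fact p.Prime] [CharP K p] :
    ¬ CampaignW13RFlatCanonicalPos p K (3 : Fin 4) := by
  intro h
  have key : ∀ d : LLChainData (MvPolynomial (Fin 4) K),
      d.g 0 = X 3 ^ p + X 2 ^ p * (X 0 * (X 1 - X 2) ^ (p - 1) -
        X 1 * X 2 * ∑ j ∈ Finset.range (p - 1), X 1 ^ j * X 2 ^ (p - 1 - 1 - j)) → d.e = 1 → d.tail = X 3 → False :=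
    fun d hdg hde hdt => W13.AllP_not_rFlatTailPow K p d hdg hde hdt (h d (W13.AllP_isCanonicalChain K p d hdg hde hdt))
  exact key ⟨1, fun _ => X 3,
      fun j => if j = 0 then X 3 ^ p + X 2 ^ p * (X 0 * (X 1 - X 2) ^ (p - 1) -
        X 1 * X 2 * ∑ j ∈ Finset.range (p - 1), X 1 ^ j * X 2 ^ (p - 1 - 1 - j)) else X 3,
      fun _ => X 2 ^ p * (X 0 * (X 1 - X 2) ^ (p - 1) -
        X 1 * X 2 * ∑ j ∈ Finset.range (p - 1), X 1 ^ j * X 2 ^ (p - 1 - 1 - j)),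
      fun _ => 0, fun _ => (2 * p : ℕ)⟩
    (by show (if (0 : ℕ) = 0 then X 3 ^ p + X 2 ^ p * (X 0 * (X 1 - X 2) ^ (p - 1) -
          X 1 * X 2 * ∑ j ∈ Finset.range (p - 1), X 1 ^ j * X 2 ^ (p - 1 - 1 - j)) else (X 3 : MvPolynomial (Fin 4) K)) =
          X 3 ^ p + X 2 ^ p * (X 0 * (X 1 - X 2) ^ (p - 1) -
            X 1 * X 2 * ∑ j ∈ Finset.range (p - 1), X 1 ^ j * X 2 ^ (p - 1 - 1 - j))
        exact if_pos rfl)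
    rfl
    (by show (if (1 : ℕ) = 0 then X 3 ^ p + X 2 ^ p * (X 0 * (X 1 - X 2) ^ (p - 1) -
          X 1 * X 2 * ∑ j ∈ Finset.range (p - 1), X 1 ^ j * X 2 ^ (p - 1 - 1 - j)) else (X 3 : MvPolynomial (Fin 4) K)) = X 3
        exact if_neg one_ne_zero)

/-- In particular the ∀-form of the content Prop over the chart `K[x,y,z,u]` fails in every positive characteristic: there is no
prime `p` for which `CampaignW13RFlatCanonicalPos p K (3 : Fin 4)` holds for all fields `K` of characteristic `p` — witness
`K = 𝔽_p`. [folklore] -/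
theorem not_CampaignW13RFlatCanonicalPos_zmod (p : ℕ) [Fact p.Prime] :
    ¬ CampaignW13RFlatCanonicalPos p (ZMod p) (3 : Fin 4) :=
  not_CampaignW13RFlatCanonicalPos_allChar (ZMod p) p

end HeadlineAllP

end Summit.ResolutionOfSingularities.ResolutionOfSingularities.Theorems.Campaign

end
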